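import Mathlib
import Summits.ValiantsHypothesis.ValiantsHypothesis.Theorems.BarrierLeverPartitionMinorsHitByVPHiddenStatesGreedyCutCoeff

/-!
# Route BarrierLever — item `PartitionMinorsHitByVP` (stmt-ValiantsHypothesis-19717), line `hidden_states`:
# THE GREEDY PIECE CUT, part 2/2 — extreme term at the UNIQUE lightest base; no threshold hypothesis

Helper file (`--supports stmt-ValiantsHypothesis-19717`; cell valiant-natproofs, rung V4, 𝒟-side door (c); prover seat
val-np-p3 gen 20). Pure linear algebra (two bookkeeping `def`s: `rowVec`, the predicate `IsBase`). Closes NO item.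

THE POINT (memo HOME/val-np-p3/g20/MEMO-blockpeeling-valnp3-g20.md §3). The row-threshold lemma
`SimplexJoin.exists_rowScale_det_ne_zero` (p611971) needs the `|P|` lightest rows to be a strict threshold slice on which the
block `R × P` is nonsingular. For structured (non-free) columns that fails exactly where one needs it: the lightest rows may be
DEPENDENT for the block (three singleton monomials against a pair block, singleton-petal sunflowers `{C+a, C+b, C+c}`, unions
of such sunflowers — for which NO linear weight isolates a nonsingular triple). This file removes the hypothesis:

* `IsBase N P R` — `|R| = |P|` and the rows `R` restricted to the columns `P` are linearly independent;
  `det_blockZero_eq_zero_of_not_isBase`, `isBase_of_det_ne_zero` (conversions), `IsBase.mem_span` (a base spans).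
* `IsBase.exchange` — the basis EXCHANGE lemma for the row matroid of the column block (via `Finsupp.linearCombination`).
* `IsBase.eq_of_minWeight` — for a weight `wt` INJECTIVE on rows the minimum of `Σ_{i∈R} wt i` over bases is attained at a
  UNIQUE base (exchange the lightest element of the symmetric difference).
* **`exists_rowScale_det_ne_zero_of_bases`** (THE GREEDY CUT): if some base exists and `det (blockZero N R P) ≠ 0` for EVERY
  base `R` (the complementary block `Rᶜ × Pᶜ` is nonsingular whenever `R × P` is — `det_blockZero_ne_zero`), then some scaling
  `c` makes `rowScale N P wt c` nonsingular: the coefficient of `X^{w₀}` (`w₀` = the minimum weight of a base) in the symbolic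
  determinant is `det (blockZero N R₀ P)` alone, every other row set of weight `w₀` being a non-base (part 1's formula).
  In a peeling induction the second hypothesis is what «the remaining columns are good for EVERY row family of their size»
  supplies, so the lightest base never has to be computed.

USE (next files of the seat): with a zero base point, scaling the STATES of one block of a hidden-state piece by `c^{ω a}` in
coordinate `a` multiplies exactly that block's columns by `c^{Σ_{a∈u i} ω a}` (binary `ω` is injective on an injective row
family, `SimplexJoin.binaryWeight_injective`), so blocks peel one at a time; the pair block `{g, g', g+g'}` has full rank on
every family of more than `h` monomials (triple lemma), which gives the MATCHING THEOREM (the piece «`K` singletons + `Δ`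
disjoint pairs» is uniform for `K ≥ 2Δ + h − 3`). WHAT THIS IS NOT: no design is proved good in this file; item 19717 stays
OPEN; nothing on crux 14610 or VP ≠ VNP.
-/

set_option linter.dupNamespace false

namespace Summit.ValiantsHypothesis.ValiantsHypothesis.Theorems.BarrierLever.HiddenStates

open Finset Matrix

noncomputable section

namespace GreedyCut

variable {r : ℕ}

/-! ## 2. Bases of the row matroid of the column block, exchange, uniqueness of the lightest base -/

/-- Row `i` of `N` restricted to the columns `P`, as a vector indexed by `↥P`. -/
def rowVec (N : Matrix (Fin r) (Fin r) ℂ) (P : Finset (Fin r)) (i : Fin r) : (P → ℂ) :=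
  fun k => N i k

/-- `R` is a BASE for the column block `P`: `|R| = |P|` and the rows `R`, restricted to `P`, are linearly independent. -/
def IsBase (N : Matrix (Fin r) (Fin r) ℂ) (P R : Finset (Fin r)) : Prop :=
  R.card = P.card ∧ LinearIndepOn ℂ (rowVec N P) (R : Set (Fin r))

/-- A non-base of the right size has `det (blockZero N R P) = 0`. -/
theorem det_blockZero_eq_zero_of_not_isBase (N : Matrix (Fin r) (Fin r) ℂ) (P R : Finset (Fin r))
    (hcard : R.card = P.card) (hnb : ¬ IsBase N P R) : (blockZero N R P).det = 0 := by
  classical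
  have hdep : ¬ LinearIndepOn ℂ (rowVec N P) (R : Set (Fin r)) := fun h => hnb ⟨hcard, h⟩
  rw [linearIndepOn_iff] at hdep
  push Not at hdep
  obtain ⟨l, hl, hcomb, hl0⟩ := hdep
  rw [Finsupp.mem_supported] at hl
  refine det_blockZero_eq_zero' N R P l (fun h => hl0 (Finsupp.ext fun i => by
    have := congrFun h i; simpa using this)) (fun i hi => ?_) (fun k hk => ?_)
  · by_contra hne
    exact hi (hl (by simpa using hne))
  · have hk' := congrFun hcomb ⟨k, hk⟩
    rw [Finsupp.linearCombination_apply, Finsupp.sum] at hk'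
    simp only [Finset.sum_apply, Pi.smul_apply, smul_eq_mul, Pi.zero_apply] at hk'
    rw [← hk']
    symm
    refine Finset.sum_subset (fun i hi => hl hi) fun i _ hi => ?_
    rw [Finsupp.notMem_support_iff.mp hi, zero_mul]

/-- The rows of a base span all of `↥P → ℂ`. -/
theorem IsBase.mem_span {N : Matrix (Fin r) (Fin r) ℂ} {P R : Finset (Fin r)} (hR : IsBase N P R) (x : P → ℂ) :
    x ∈ Submodule.span ℂ (rowVec N P '' (R : Set (Fin r))) := by
  classical
  have hli : LinearIndependent ℂ (fun i : (R : Set (Fin r)) => rowVec N P i) := hR.2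
  have hcard : Fintype.card (R : Set (Fin r)) = Module.finrank ℂ (P → ℂ) := by
    rw [Module.finrank_fintype_fun_eq_card, Fintype.card_coe]
    simp [hR.1]
  have htop := hli.span_eq_top_of_card_eq_finrank' hcard
  have hx : x ∈ (⊤ : Submodule ℂ (P → ℂ)) := Submodule.mem_top
  rw [← htop] at hx
  rwa [← Set.image_eq_range] at hx

/-- **Exchange.** If `R, R'` are bases and `i ∈ R ∖ R'`, some `j ∈ R' ∖ R` can be traded for `i`:
`insert i (R'.erase j)` is again a base. -/
theorem IsBase.exchange {N : Matrix (Fin r) (Fin r) ℂ} {P R R' : Finset (Fin r)} (hR : IsBase N P R)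
    (hR' : IsBase N P R') {i : Fin r} (hiR : i ∈ R) (hiR' : i ∉ R') :
    ∃ j ∈ R', j ∉ R ∧ IsBase N P (insert i (R'.erase j)) := by
  classical
  set v := rowVec N P with hv
  -- write `v i` in terms of the base `R'`
  obtain ⟨l, hl, hli⟩ := (Finsupp.mem_span_image_iff_linearCombination ℂ).mp (hR'.mem_span (v i))
  rw [Finsupp.mem_supported] at hl
  -- some coefficient outside `R` is nonzero
  have hj : ∃ j ∈ l.support, j ∉ R := by
    by_contra hcon
    push Not at hcon
    -- then `v i` lies in the span of `v '' (R \ {i})`, contradicting independence on `R`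
    have hmem : v i ∈ Submodule.span ℂ (v '' ((R : Set (Fin r)) \ {i})) := by
      rw [Finsupp.mem_span_image_iff_linearCombination ℂ]
      refine ⟨l, ?_, hli⟩
      rw [Finsupp.mem_supported]
      intro j hj
      refine ⟨hcon j (by simpa using hj), ?_⟩
      rintro rfl
      exact hiR' (hl (by simpa using hj))
    exact hR.2.notMem_span (by simpa using hiR) hmem
  obtain ⟨j, hjl, hjR⟩ := hj
  have hjR' : j ∈ R' := hl (by simpa using hjl)
  refine ⟨j, hjR', hjR, ?_, ?_⟩
  · rw [Finset.card_insert_of_notMem (fun h => hiR' (Finset.mem_of_mem_erase h)),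
      Finset.card_erase_of_mem hjR', hR'.1]
    have : 0 < P.card := by rw [← hR'.1]; exact Finset.card_pos.mpr ⟨j, hjR'⟩
    omega
  · -- independence of `insert i (R' \ {j})`
    have hsub : ((R'.erase j : Finset (Fin r)) : Set (Fin r)) ⊆ (R' : Set (Fin r)) := by
      intro x hx
      rw [Finset.mem_coe] at hx ⊢
      exact Finset.mem_of_mem_erase hx
    have hind : LinearIndepOn ℂ v ((R'.erase j : Finset (Fin r)) : Set (Fin r)) := hR'.2.mono hsub
    have hnot : i ∉ ((R'.erase j : Finset (Fin r)) : Set (Fin r)) := fun h => hiR' (hsub h)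
    rw [Finset.coe_insert, linearIndepOn_insert hnot]
    refine ⟨hind, fun hmem => ?_⟩
    obtain ⟨l', hl', hli'⟩ := (Finsupp.mem_span_image_iff_linearCombination ℂ).mp hmem
    rw [Finsupp.mem_supported] at hl'
    -- `l - l'` is a relation supported on `R'`, hence zero; but it is nonzero at `j`
    have hrel : l - l' = 0 := by
      refine (linearIndepOn_iff.mp hR'.2) (l - l') ?_ ?_
      · rw [Finsupp.mem_supported]
        intro x hx
        have hx' : x ∈ l.support ∪ l'.support := Finsupp.support_sub hx
        rcases Finset.mem_union.mp hx' with h | h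
        · exact hl (by simpa using h)
        · exact hsub (hl' (by simpa using h))
      · rw [map_sub, hli, hli', sub_self]
    have hlj : l j = l' j := by
      have := congrArg (fun f => f j) hrel
      simpa [sub_eq_zero] using this
    have hl'j : l' j = 0 := by
      by_contra hne
      have : j ∈ ((R'.erase j : Finset (Fin r)) : Set (Fin r)) := hl' (by simpa using hne)
      simp at this
    exact (Finsupp.mem_support_iff.mp hjl) (hlj.trans hl'j)

/-- **Uniqueness of the lightest base.** For a weight `wt` injective on rows, two bases of minimum total weight coincide. -/
theorem IsBase.eq_of_minWeight {N : Matrix (Fin r) (Fin r) ℂ} {P R R' : Finset (Fin r)} (wt : Fin r → ℕ)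
    (hwt : Function.Injective wt) (hR : IsBase N P R) (hR' : IsBase N P R')
    (hminR : ∀ S, IsBase N P S → ∑ i ∈ R, wt i ≤ ∑ i ∈ S, wt i)
    (hminR' : ∀ S, IsBase N P S → ∑ i ∈ R', wt i ≤ ∑ i ∈ S, wt i) : R = R' := by
  classical
  by_contra hne
  -- the symmetric difference is nonempty; take its lightest element
  set D := (R \ R') ∪ (R' \ R) with hD
  have hDne : D.Nonempty := by
    rw [hD]
    by_contra hemp
    rw [Finset.not_nonempty_iff_eq_empty, Finset.union_eq_empty, Finset.sdiff_eq_empty_iff_subset,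
      Finset.sdiff_eq_empty_iff_subset] at hemp
    exact hne (Finset.Subset.antisymm hemp.1 hemp.2)
  obtain ⟨i₀, hi₀D, hi₀min⟩ := Finset.exists_min_image D wt hDne
  -- a generic step: exchanging the lightest element of `D` into the other base lowers its weight
  have key : ∀ {A B : Finset (Fin r)}, IsBase N P A → IsBase N P B →
      (∀ S, IsBase N P S → ∑ i ∈ B, wt i ≤ ∑ i ∈ S, wt i) →
      i₀ ∈ A → i₀ ∉ B → (∀ x, x ∈ B → x ∉ A → wt i₀ ≤ wt x) → False := by
    intro A B hA hB hminB hiA hiB hDmin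
    obtain ⟨j, hjB, hjA, hbase⟩ := hA.exchange hB hiA hiB
    have hle := hminB _ hbase
    have hlt : wt i₀ < wt j := by
      refine lt_of_le_of_ne (hDmin j hjB hjA) (fun h => ?_)
      exact hjA (hwt h ▸ hiA)
    have hsum : ∑ i ∈ insert i₀ (B.erase j), wt i + wt j = ∑ i ∈ B, wt i + wt i₀ := by
      rw [Finset.sum_insert (fun h => hiB (Finset.mem_of_mem_erase h)), ← Finset.add_sum_erase B wt hjB]
      ring
    omega
  rcases Finset.mem_union.mp hi₀D with h | h
  · rw [Finset.mem_sdiff] at h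
    exact key hR hR' hminR' h.1 h.2 (fun x hxB hxA => hi₀min x (by
      rw [hD, Finset.mem_union, Finset.mem_sdiff, Finset.mem_sdiff]; exact Or.inr ⟨hxB, hxA⟩))
  · rw [Finset.mem_sdiff] at h
    exact key hR' hR hminR h.1 h.2 (fun x hxB hxA => hi₀min x (by
      rw [hD, Finset.mem_union, Finset.mem_sdiff, Finset.mem_sdiff]; exact Or.inl ⟨hxB, hxA⟩))

/-! ## 3. The greedy cut -/

/-- **THE GREEDY CUT.** If the column block `P` has SOME base and the block-zeroed matrix is nonsingular at EVERY base
(i.e. the complementary block `Rᶜ × Pᶜ` is nonsingular whenever `R × P` is), then some scaling `c` of the `P`-columns by the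
row factors `c ^ wt i` (any `wt` injective on rows) makes `N` nonsingular. -/
theorem exists_rowScale_det_ne_zero_of_bases (N : Matrix (Fin r) (Fin r) ℂ) (P : Finset (Fin r)) (wt : Fin r → ℕ)
    (hwt : Function.Injective wt) (hex : ∃ R, IsBase N P R)
    (hrest : ∀ R, IsBase N P R → (blockZero N R P).det ≠ 0) :
    ∃ c : ℂ, (rowScale N P wt c).det ≠ 0 := by
  classical
  -- the lightest base
  set 𝔅 := (Finset.univ.powersetCard P.card).filter (fun R : Finset (Fin r) => IsBase N P R) with h𝔅
  have hmem𝔅 : ∀ R, R ∈ 𝔅 ↔ IsBase N P R := by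
    intro R
    rw [h𝔅, Finset.mem_filter, Finset.mem_powersetCard]
    exact ⟨fun h => h.2, fun h => ⟨⟨Finset.subset_univ _, h.1⟩, h⟩⟩
  have h𝔅ne : 𝔅.Nonempty := by
    obtain ⟨R, hR⟩ := hex
    exact ⟨R, (hmem𝔅 R).mpr hR⟩
  obtain ⟨R₀, hR₀𝔅, hR₀min⟩ := Finset.exists_min_image 𝔅 (fun R => ∑ i ∈ R, wt i) h𝔅ne
  have hR₀ : IsBase N P R₀ := (hmem𝔅 R₀).mp hR₀𝔅
  have hmin : ∀ S, IsBase N P S → ∑ i ∈ R₀, wt i ≤ ∑ i ∈ S, wt i :=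
    fun S hS => hR₀min S ((hmem𝔅 S).mpr hS)
  set w₀ := ∑ i ∈ R₀, wt i with hw₀
  -- the coefficient of `X^{w₀}` is `det (blockZero N R₀ P)`
  have hcoeff : (rowScaleX N P wt).det.coeff w₀ = (blockZero N R₀ P).det := by
    rw [coeff_det_rowScale_eq_sum]
    set S := (Finset.univ.powersetCard P.card).filter (fun R : Finset (Fin r) => ∑ i ∈ R, wt i = w₀) with hS
    have hR₀S : R₀ ∈ S := by
      rw [hS, Finset.mem_filter, Finset.mem_powersetCard]
      exact ⟨⟨Finset.subset_univ _, hR₀.1⟩, rfl⟩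
    rw [← Finset.add_sum_erase S _ hR₀S]
    have hzero : ∑ R ∈ S.erase R₀, (blockZero N R P).det = 0 := by
      refine Finset.sum_eq_zero fun R hR => ?_
      rw [Finset.mem_erase, hS, Finset.mem_filter, Finset.mem_powersetCard] at hR
      obtain ⟨hne, ⟨-, hcard⟩, hwR⟩ := hR
      refine det_blockZero_eq_zero_of_not_isBase N P R hcard fun hRb => hne ?_
      exact IsBase.eq_of_minWeight wt hwt hRb hR₀ (fun S' hS' => hwR ▸ hmin S' hS') hmin
    rw [hzero, add_zero]
  -- hence the symbolic determinant is a nonzero polynomial and has a non-root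
  have hdet : (rowScaleX N P wt).det ≠ 0 := by
    intro h0
    have := hcoeff
    rw [h0, Polynomial.coeff_zero] at this
    exact hrest R₀ hR₀ this.symm
  by_contra hall
  push Not at hall
  apply hdet
  refine Polynomial.funext fun c => ?_
  rw [Polynomial.eval_zero, eval_det_rowScaleX]
  exact hall c

/-- The block-zeroed matrix is nonsingular as soon as both diagonal blocks are (re-export of
`SimplexJoin.det_blockZero_ne_zero` in this file's vocabulary). -/
theorem det_blockZero_ne_zero {n n' : ℕ} (N : Matrix (Fin r) (Fin r) ℂ) (P R : Finset (Fin r))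
    (er ec : Fin n ⊕ Fin n' ≃ Fin r)
    (hR : ∀ i, i ∈ R ↔ ∃ x, er (Sum.inl x) = i) (hP : ∀ k, k ∈ P ↔ ∃ x, ec (Sum.inl x) = k)
    (hA : (Matrix.of fun x x' : Fin n => N (er (Sum.inl x)) (ec (Sum.inl x'))).det ≠ 0)
    (hD : (Matrix.of fun y y' : Fin n' => N (er (Sum.inr y)) (ec (Sum.inr y'))).det ≠ 0) :
    (blockZero N R P).det ≠ 0 :=
  SimplexJoin.det_blockZero_ne_zero N P R er ec hR hP hA hD

/-- Conversely to `det_blockZero_eq_zero_of_not_isBase`: a nonsingular square block `R × P` (in any enumeration) is a base. -/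
theorem isBase_of_det_ne_zero {n : ℕ} (N : Matrix (Fin r) (Fin r) ℂ) (P R : Finset (Fin r))
    (eR : Fin n ≃ R) (eP : Fin n ≃ P)
    (hA : (Matrix.of fun x x' : Fin n => N (eR x) (eP x')).det ≠ 0) : IsBase N P R := by
  classical
  have hcardR : R.card = n := by rw [← Fintype.card_coe, ← Fintype.card_congr eR, Fintype.card_fin]
  have hcardP : P.card = n := by rw [← Fintype.card_coe, ← Fintype.card_congr eP, Fintype.card_fin]
  refine ⟨hcardR.trans hcardP.symm, ?_⟩
  -- rows of the square block are independent; transport along the equivalences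
  set A : Matrix (Fin n) (Fin n) ℂ := Matrix.of fun x x' : Fin n => N (eR x) (eP x') with hAdef
  have hli : LinearIndependent ℂ (fun x : Fin n => A x) :=
    Matrix.linearIndependent_rows_iff_isUnit.mpr ((Matrix.isUnit_iff_isUnit_det A).mpr (isUnit_iff_ne_zero.mpr hA))
  -- `A x = (rowVec N P (eR x)) ∘ eP`
  have hcomp : LinearIndependent ℂ (fun x : Fin n => rowVec N P (eR x)) := by
    let L : (P → ℂ) →ₗ[ℂ] (Fin n → ℂ) := LinearMap.funLeft ℂ ℂ eP
    have hL : Function.Injective L := LinearMap.funLeft_injective_of_surjective _ _ _ eP.surjective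
    refine LinearIndependent.of_comp L ?_
    have : (L ∘ fun x : Fin n => rowVec N P (eR x)) = fun x => A x := by
      funext x x'
      simp [L, LinearMap.funLeft, rowVec, hAdef]
    rw [this]
    exact hli
  -- reindex by `eR : Fin n ≃ ↥R`
  let e : Fin n ≃ (R : Set (Fin r)) := eR.trans (Equiv.subtypeEquivRight (fun x => by simp))
  have key : (fun i : (R : Set (Fin r)) => rowVec N P i) ∘ e = fun x => rowVec N P (eR x) := by
    funext x
    rfl
  exact (linearIndependent_equiv' e key).mp hcomp

end GreedyCut

end

end Summit.ValiantsHypothesis.ValiantsHypothesis.Theorems.BarrierLever.HiddenStates
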